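import Literature.MathematicalPhysics.QuantumFieldTheory.Balaban1983to89.B1Eq324BenfattoAppendixC2
import Literature.MathematicalPhysics.QuantumFieldTheory.Balaban1983to89.B1Eq324BenfattoAppendixCLemma2
import Literature.MathematicalPhysics.QuantumFieldTheory.Balaban1983to89.B1Eq324BenfattoMarkov
import Literature.MathematicalPhysics.QuantumFieldTheory.Balaban1983to89.B1Eq324BenfattoCondLaw
import HarnessLib

/-!
# `Balaban1983to89.B1Eq324BenfattoDisintegration` — [BenfattoEtAl1978] §5 (5.13) p. 155 in TOWER FORM: the regression-defined
# conditioned field `P̄_{z̄} = condField d α β Γ z̄` of the tree IS a version of the conditional law of the free field `P̂₀ = P0 d α β`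
# given `z_Γ` — `P̂₀ = ∫ P̄_{z̄} dP̂₀(z̄)`, PROVED

statement-level skeleton of published theorems with citation tags; proofs where landed; nothing here is a claim about the
Yang–Mills mass gap

WHY THIS MODULE (cell `pub-ymgap`, seat `dag-n08-d` gen 8; node N08 [Balaban1985UV3]; in-edge SOURCE chain behind the (α)-row `h324c`:
[B10] (24)/(58) ← [B1] (3.24) ← [BenfattoEtAl1978] Lemma p. 152 = `B1Eq324BenfattoLemma.BasicLemmaPrinted`).  The typed lemma
(p463705) DEFINES print's «P̂₀(dz|(z̄_Δ)_{Δ∈C}) … hereafter abriged as P̄(dz)» by the Gaussian regression formula (`condField` = the field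
of mean `condMean` and covariance `condCov`) and records as HONEST SCOPE: *"its identification with a regular conditional distribution of
`P0` given the coordinates in `C` … is NOT proved here"*.  §5 of [BenfattoEtAl1978] USES that identification at (5.13) p. 155 in the
tower form *"[(5.12)] = ∫ P(dz_{Γ₁}) Π_□ … ∫ P(dz_□̃|z_{Γ₁}) …  where P(dz_{Γ₁}) denotes the probability distribution of the r.v.
(z_Δ)_{Δ⊂Γ₁} = z_{Γ₁}, … P(dz_□̃|z_{Γ₁}) is their conditional probability for fixed z_{Γ₁}"*.  This file PROVES the tower identity for
the tree's objects, closing that honest-scope item in exactly the form print needs: integrating first with `P̄_{z̄}` and then over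
`z̄ ~ P̂₀` reproduces `P̂₀`.

WHAT IS PROVED (no definition, no named fact, no `sorry`; axioms standard; `α, β > 0`, `Γ` any finite region, `K = freeCov d α β`,
`C^Γ = condCov K Γ`, `u(z̄) = condMean K Γ z̄`, `Q` = the centred Gaussian field of `C^Γ`).  The coupling identity `P̂₀ = (P̂₀ ⊗ Q) ∘
(z̄, ζ ↦ u(z̄) + ζ)⁻¹` (Gaussian regression as an identity of measures) is seat n08-b's `B1Eq324BenfattoCondLaw.map_coupling_eq_P0`
(p532605; this seat's independently typed copy was withdrawn before filing — bus COLLISION-2), used here BY NAME: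
* ★ `integral_P0_eq_integral_condField` — THE TOWER IDENTITY `∫ F dP̂₀ = ∫ (∫ F dP̄_{z̄}) dP̂₀(z̄)` for every measurable
  `P̂₀`-INTEGRABLE `F` (Fubini on the coupling; `P̄_{z̄} = Q ∘ (ζ ↦ u(z̄) + ζ)⁻¹` by definition).  n08-b's `integral_condField_eq` is the
  twin for BOUNDED `g(z̄|_Γ, z)` (explicit dependence on the conditioning data); neither statement contains the other.
* ★★ `integral_P0_prod_eq_integral_prod_condField` — (5.13) AS PRINTED: for finitely many pairwise disjoint `Γ`-enclosed regions `Ω_i`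
  and measurable observables `f_i` of `z|_{Ω_i}` with `Π_i f_i` integrable, `∫ Π_i f_i dP̂₀ = ∫ [Π_i ∫ f_i dP̄_{z̄}] dP̂₀(z̄)` — tower +
  the mutual independence of the box fields under `P̄_{z̄}` (`B1Eq324BenfattoMarkov.iIndepFun_condField_of_enclosed`).
* §8 `enclosed_of_outerBoundary_subset`, `box_enclosed_of_collar_subset` — the «Γ-enclosed» hypothesis of the Markov / factorisation
  theorems discharged for print's geometry: a lattice box is enclosed by its unit collar (so the box field conditioned on the collar —
  a fortiori on a corridor `Γ₁(□)` of width `b^{3/2} ≥ 1` — is independent of the outside).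
* §9 (v1.1) `integral_P0_prefactor_mul_prod_eq` — (5.13) WITH its `z_{Γ₁}`-dependent prefactor: `∫ h(z|_Γ)·Π_i f_i dP̂₀ =
  ∫ h(z̄|_Γ)·[Π_i ∫ f_i dP̄_{z̄}] dP̂₀(z̄)` for bounded measurable `h`, `f_i` (n08-b's bounded-`g` tower + the mutual independence).
Companions: `B1Eq324BenfattoMarkov` (this seat: the Markov property — under `P̄_{z̄}` the field inside a `Γ`-enclosed region is
independent of the field outside — and (C.6)/(C.7) structure), n08-b's `…CondLaw` / `…CondCentre` / `…AppendixC2` / `…AppendixCLemma2`.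
HONEST SCOPE.  The tower identity is the disintegration of `P̂₀` along `z̄ ↦ P̄_{z̄}` as used at (5.13); packaging it as Mathlib's
`condDistrib`/`condExpKernel` equality is not done here.  count-neutral for N08; `BasicLemmaPrinted` NOT discharged; nothing about d = 4,
the continuum, OS axioms, a mass gap or the Clay problem.
-/

noncomputable section

open Finset Matrix
open scoped BigOperators Matrix

namespace Literature.MathematicalPhysics.QuantumFieldTheory.Balaban1983to89.B1Eq324BenfattoDisintegration

open Literature.MathematicalPhysics.QuantumFieldTheory
open Literature.MathematicalPhysics.QuantumFieldTheory.Balaban1983to89.B3Sect3VectorSelfEnergy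
open Literature.MathematicalPhysics.QuantumFieldTheory.Balaban1983to89.B3WT226FreeLattice
open Literature.MathematicalPhysics.QuantumFieldTheory.Balaban1983to89.B1Eq324BenfattoLemma
open Literature.MathematicalPhysics.QuantumFieldTheory.Balaban1983to89.B1Eq324BenfattoCondCentre
open Literature.MathematicalPhysics.QuantumFieldTheory.Balaban1983to89.B1Eq324BenfattoAppendixC2
open Literature.MathematicalPhysics.QuantumFieldTheory.Balaban1983to89.B1Eq324BenfattoAppendixCLemma2
open Literature.MathematicalPhysics.QuantumFieldTheory.Balaban1983to89.B1Eq324BenfattoMarkov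
open Literature.MathematicalPhysics.QuantumFieldTheory.Balaban1983to89.B1Eq324BenfattoCondLaw

variable {d : ℕ}

section Disintegration

open _root_.MeasureTheory _root_.ProbabilityTheory

variable {α β : ℝ}

/-- **THE TOWER IDENTITY OF (5.13): `∫ F dP̂₀ = ∫ (∫ F dP̄_{z̄}) dP̂₀(z̄)`** — integrating first with the conditioned field
`P̄_{z̄} = condField d α β Γ z̄` and then over the conditioning data `z̄ ~ P̂₀` reproduces `P̂₀`: the tree's regression-defined
`condField` IS a version of the conditional law of `P̂₀` given `z_Γ` (closing p463705's honest-scope item), in exactly the form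
print uses it («∫ P(dz_{Γ₁}) ∫ … P(dz_□̃|z_{Γ₁})», p. 155). For `F` measurable and `P̂₀`-INTEGRABLE (seat n08-b's
`B1Eq324BenfattoCondLaw.integral_condField_eq` is the twin for BOUNDED `g(z̄|_Γ, z)` with explicit dependence on the conditioning data;
the coupling identity `P̂₀ = (P̂₀ ⊗ Q) ∘ (z̄, ζ ↦ u(z̄) + ζ)⁻¹` used here is n08-b's `map_coupling_eq_P0`). [cite: BenfattoEtAl1978, §5 (5.13) p.155] -/
theorem integral_P0_eq_integral_condField (hα : 0 < α) (hβ : 0 < β) (Γ : Finset (ZSite d))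
    {F : (ZSite d → ℝ) → ℝ} (hFm : Measurable F) (hFi : Integrable F (P0 d α β)) :
    ∫ z, F z ∂P0 d α β = ∫ zbar, (∫ z, F z ∂condField d α β Γ zbar) ∂P0 d α β := by
  have hKc := isPosSemidefKernel_condCov_freeCov (d := d) hα hβ Γ
  set K := freeCov d α β with hKdef
  set Q := gaussianFieldOfKernel (condCov K Γ) with hQ
  haveI : IsProbabilityMeasure (P0 d α β) := isProbabilityMeasure_P0 hα hβ
  haveI : IsProbabilityMeasure Q := isProbabilityMeasure_gaussianFieldOfKernel hKc
  set T : (ZSite d → ℝ) × (ZSite d → ℝ) → (ZSite d → ℝ) := fun p x => condMean K Γ p.1 x + p.2 x with hT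
  have hum : ∀ x, Measurable fun z : ZSite d → ℝ => condMean K Γ z x := by
    intro x
    simp only [condMean]
    refine Finset.measurable_sum _ fun c _ => Finset.measurable_sum _ fun c' _ => ?_
    exact (measurable_const.mul (measurable_pi_apply _))
  have hTm : Measurable T :=
    measurable_pi_lambda _ fun x => ((hum x).comp measurable_fst).add ((measurable_pi_apply x).comp measurable_snd)
  have hP : P0 d α β = ((P0 d α β).prod Q).map T := (map_coupling_eq_P0 (d := d) hα hβ Γ).symm
  -- `∫ F dP0 = ∫ F ∘ T d(P0 ⊗ Q)` and Fubini
  have h1 : ∫ z, F z ∂P0 d α β = ∫ p, F (T p) ∂(P0 d α β).prod Q := by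
    conv_lhs => rw [hP]
    rw [integral_map hTm.aemeasurable hFm.aestronglyMeasurable]
  have hFi' : Integrable (fun p => F (T p)) ((P0 d α β).prod Q) := by
    have h := (integrable_map_measure hFm.aestronglyMeasurable hTm.aemeasurable).mp (by rw [← hP]; exact hFi)
    exact h
  rw [h1, integral_prod _ hFi']
  refine integral_congr_ae (Filter.Eventually.of_forall fun zbar => ?_)
  -- inner integral: `∫ F(u(z̄) + ζ) dQ(ζ) = ∫ F dP̄_{z̄}`
  have hTz : Measurable fun ζ : ZSite d → ℝ => T (zbar, ζ) := hTm.comp (measurable_const.prodMk measurable_id)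
  change ∫ ζ, F (T (zbar, ζ)) ∂Q = ∫ z, F z ∂condField d α β Γ zbar
  rw [show condField d α β Γ zbar = Q.map (fun ζ : ZSite d → ℝ => T (zbar, ζ)) from rfl,
    integral_map hTz.aemeasurable hFm.aestronglyMeasurable]

/-- **(5.13) AS PRINTED — CONDITIONING ON THE CORRIDORS FACTORIZES THE INTEGRAL OVER THE BOXES**: p. 155, *"[(5.12)] =
∫ P(dz_{Γ₁}) Π_{□: □∩J=∅} (…) · Π_{□: □∩J≠∅} [∫ P(dz_□̃|z_{Γ₁}) Π_Δ χ̂_Δ exp Ψ_□] … and the Markov property of P has been used"*.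
PROVED for the tree's objects: for finitely many pairwise disjoint `Γ`-enclosed regions `Ω_i` and observables `f_i` of the field in `Ω_i`,
`∫ Π_i f_i(z|_{Ω_i}) dP̂₀ = ∫ [Π_i ∫ f_i(z|_{Ω_i}) dP̄_{z̄}] dP̂₀(z̄)` — the tower identity (`integral_P0_eq_integral_condField`) followed by
the mutual independence of the box fields under `P̄_{z̄}` (`B1Eq324BenfattoMarkov.iIndepFun_condField_of_enclosed`).
[cite: BenfattoEtAl1978, §5 (5.13) p.155] -/
theorem integral_P0_prod_eq_integral_prod_condField (hα : 0 < α) (hβ : 0 < β) (Γ : Finset (ZSite d)) {ι : Type*} [Fintype ι]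
    {Ω : ι → Set (ZSite d)} (hΩΓ : ∀ i, ∀ z ∈ Ω i, z ∉ Γ)
    (hΩ : ∀ i, ∀ z ∈ Ω i, ∀ μ : Fin d,
      (z + unitVec μ ∈ Ω i ∨ z + unitVec μ ∈ Γ) ∧ (z - unitVec μ ∈ Ω i ∨ z - unitVec μ ∈ Γ))
    (hdisj : ∀ i j, i ≠ j → Disjoint (Ω i) (Ω j))
    (f : (i : ι) → ((Ω i) → ℝ) → ℝ) (hf : ∀ i, Measurable (f i))
    (hint : Integrable (fun z : ZSite d → ℝ => ∏ i, f i (fun s : Ω i => z s)) (P0 d α β)) :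
    ∫ z, ∏ i, f i (fun s : Ω i => z s) ∂P0 d α β
      = ∫ zbar, ∏ i, (∫ z, f i (fun s : Ω i => z s) ∂condField d α β Γ zbar) ∂P0 d α β := by
  have hXm : ∀ i, Measurable fun (z : ZSite d → ℝ) (s : Ω i) => z s :=
    fun i => measurable_pi_lambda _ fun s => measurable_pi_apply _
  have hFm : Measurable fun z : ZSite d → ℝ => ∏ i, f i (fun s : Ω i => z s) :=
    Finset.measurable_prod _ fun i _ => (hf i).comp (hXm i)
  rw [integral_P0_eq_integral_condField hα hβ Γ hFm hint]
  refine integral_congr_ae (Filter.Eventually.of_forall fun zbar => ?_)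
  exact (iIndepFun_condField_of_enclosed hα hβ Γ hΩΓ hΩ hdisj zbar).integral_fun_prod_comp
    (fun i => (hXm i).aemeasurable) fun i => (hf i).aestronglyMeasurable

end Disintegration

/-! ## §8  Print's boxes are enclosed regions (the hypothesis of the Markov / factorisation theorems, discharged for lattice boxes) -/

section Boxes

/-- **A region together with its missing neighbours is enclosed**: if `Γ` contains every lattice neighbour of `Ω` that is not in `Ω`
(the outer vertex boundary of `Ω`) and misses `Ω`, then `Ω` is `Γ`-enclosed in the sense of `condCov_freeCov_eq_zero_of_enclosed` —
print's boxes `□ ∪ Γ₂(□)` inside their corridors `Γ₁(□)`. [cite: BenfattoEtAl1978, §5 (5.7) p.154, (5.13) p.155] -/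
theorem enclosed_of_outerBoundary_subset {Ω : Set (ZSite d)} {Γ : Finset (ZSite d)}
    (hout : ∀ z ∈ Ω, ∀ μ : Fin d, (z + unitVec μ ∉ Ω → z + unitVec μ ∈ Γ) ∧ (z - unitVec μ ∉ Ω → z - unitVec μ ∈ Γ)) :
    ∀ z ∈ Ω, ∀ μ : Fin d, (z + unitVec μ ∈ Ω ∨ z + unitVec μ ∈ Γ) ∧ (z - unitVec μ ∈ Ω ∨ z - unitVec μ ∈ Γ) := by
  intro z hz μ
  refine ⟨?_, ?_⟩
  · by_cases h : z + unitVec μ ∈ Ω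
    · exact Or.inl h
    · exact Or.inr ((hout z hz μ).1 h)
  · by_cases h : z - unitVec μ ∈ Ω
    · exact Or.inl h
    · exact Or.inr ((hout z hz μ).2 h)

/-- **Boxes are enclosed by their unit collar**: the lattice box `B = {z | ∀ i, a i ≤ z i ≤ b i}` is `Γ`-enclosed as soon as `Γ` contains the
collar `{z ∉ B | ∀ i, a i − 1 ≤ z i ≤ b i + 1}` (and then the Markov property / independence theorems apply to the field in `B` conditioned
on the collar). [cite: BenfattoEtAl1978, §5 (5.7) p.154, (5.13) p.155] -/
theorem box_enclosed_of_collar_subset (a b : Fin d → ℤ) {Γ : Finset (ZSite d)}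
    (hΓ : ∀ z : ZSite d, (¬ ∀ i, a i ≤ z i ∧ z i ≤ b i) → (∀ i, a i - 1 ≤ z i ∧ z i ≤ b i + 1) → z ∈ Γ) :
    ∀ z ∈ {z : ZSite d | ∀ i, a i ≤ z i ∧ z i ≤ b i}, ∀ μ : Fin d,
      (z + unitVec μ ∈ {z : ZSite d | ∀ i, a i ≤ z i ∧ z i ≤ b i} ∨ z + unitVec μ ∈ Γ) ∧
      (z - unitVec μ ∈ {z : ZSite d | ∀ i, a i ≤ z i ∧ z i ≤ b i} ∨ z - unitVec μ ∈ Γ) := by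
  refine enclosed_of_outerBoundary_subset fun z hz μ => ⟨fun h => hΓ _ h fun i => ?_, fun h => hΓ _ h fun i => ?_⟩
  · have hzi := hz i
    by_cases hi : i = μ
    · subst hi
      simp only [Pi.add_apply, unitVec_apply, if_true]
      omega
    · simp only [Pi.add_apply, unitVec_apply, if_neg hi, add_zero]
      omega
  · have hzi := hz i
    by_cases hi : i = μ
    · subst hi
      simp only [Pi.sub_apply, unitVec_apply, if_true]
      omega
    · simp only [Pi.sub_apply, unitVec_apply, if_neg hi, sub_zero]
      omega

end Boxes

/-! ## §9  (5.13) with its `z_{Γ₁}`-dependent prefactor (v1.1; ref-C READ-255 NIT-2) -/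

section Prefactor

open _root_.MeasureTheory _root_.ProbabilityTheory
open Literature.MathematicalPhysics.QuantumFieldTheory.Balaban1983to89.B1Eq324BenfattoCondLaw

variable {α β : ℝ}

/-- **(5.13) WITH THE CORRIDOR PREFACTOR** — print's display carries, inside `∫ P̄(dz_{Γ₁})`, factors depending on the conditioning data
`z_{Γ₁}` alone (`Π_{Δ∈Γ₁} χ̂_Δ exp H_{Γ₁}`) times the box integrals: for a bounded measurable prefactor `h(z̄|_Γ)` and bounded measurable box
observables `f_i` of `z|_{Ω_i}` over finitely many pairwise disjoint `Γ`-enclosed regions,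
`∫ h(z|_Γ)·Π_i f_i(z|_{Ω_i}) dP̂₀(z) = ∫ h(z̄|_Γ)·[Π_i ∫ f_i dP̄_{z̄}] dP̂₀(z̄)` — seat n08-b's bounded-`g` tower `B1Eq324BenfattoCondLaw.integral_condField_eq`
(explicit `z̄|_Γ`-dependence) followed by the mutual independence of the box fields under `P̄_{z̄}`
(`B1Eq324BenfattoMarkov.iIndepFun_condField_of_enclosed`). [cite: BenfattoEtAl1978, §5 (5.13) p.155] -/
theorem integral_P0_prefactor_mul_prod_eq (hα : 0 < α) (hβ : 0 < β) (Γ : Finset (ZSite d)) {ι : Type*} [Fintype ι]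
    {Ω : ι → Set (ZSite d)} (hΩΓ : ∀ i, ∀ z ∈ Ω i, z ∉ Γ)
    (hΩ : ∀ i, ∀ z ∈ Ω i, ∀ μ : Fin d,
      (z + unitVec μ ∈ Ω i ∨ z + unitVec μ ∈ Γ) ∧ (z - unitVec μ ∈ Ω i ∨ z - unitVec μ ∈ Γ))
    (hdisj : ∀ i j, i ≠ j → Disjoint (Ω i) (Ω j))
    (h : (Γ → ℝ) → ℝ) (hh : Measurable h) {Mh : ℝ} (hMh : ∀ y, |h y| ≤ Mh)
    (f : (i : ι) → ((Ω i) → ℝ) → ℝ) (hf : ∀ i, Measurable (f i)) {M : ι → ℝ} (hM : ∀ i x, |f i x| ≤ M i) :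
    ∫ z, h (Γ.restrict z) * ∏ i, f i (fun s : Ω i => z s) ∂P0 d α β
      = ∫ zbar, h (Γ.restrict zbar) * ∏ i, (∫ z, f i (fun s : Ω i => z s) ∂condField d α β Γ zbar) ∂P0 d α β := by
  have hXm : ∀ i, Measurable fun (z : ZSite d → ℝ) (s : Ω i) => z s :=
    fun i => measurable_pi_lambda _ fun s => measurable_pi_apply _
  have hFm : Measurable fun z : ZSite d → ℝ => ∏ i, f i (fun s : Ω i => z s) :=
    Finset.measurable_prod _ fun i _ => (hf i).comp (hXm i)
  -- the bounded measurable integrand `g(y, z) = h(y)·Π_i f_i(z|_{Ω_i})`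
  have hg : Measurable fun q : (Γ → ℝ) × (ZSite d → ℝ) => h q.1 * ∏ i, f i (fun s : Ω i => q.2 s) :=
    (hh.comp measurable_fst).mul (hFm.comp measurable_snd)
  have hbound : ∀ q : (Γ → ℝ) × (ZSite d → ℝ), |h q.1 * ∏ i, f i (fun s : Ω i => q.2 s)| ≤ Mh * ∏ i, M i := by
    intro q
    rw [abs_mul, Finset.abs_prod]
    exact mul_le_mul (hMh _) (Finset.prod_le_prod (fun i _ => abs_nonneg _) fun i _ => hM i _) 
      (Finset.prod_nonneg fun i _ => abs_nonneg _) ((abs_nonneg _).trans (hMh q.1))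
  have htower := integral_condField_eq (d := d) hα hβ Γ hg hbound
  simp only at htower
  rw [htower]
  refine integral_congr_ae (Filter.Eventually.of_forall fun zbar => ?_)
  show ∫ z, h (Γ.restrict zbar) * ∏ i, f i (fun s : Ω i => z s) ∂condField d α β Γ zbar = _
  rw [integral_const_mul]
  congr 1
  exact (iIndepFun_condField_of_enclosed hα hβ Γ hΩΓ hΩ hdisj zbar).integral_fun_prod_comp
    (fun i => (hXm i).aemeasurable) fun i => (hf i).aestronglyMeasurable

end Prefactor

end Literature.MathematicalPhysics.QuantumFieldTheory.Balaban1983to89.B1Eq324BenfattoDisintegration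

end
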